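import Summits.QuantumFields.YangMills.Theorems.MirrorModularBoostsHypercubicLimitOfLineInputs
import Summits.QuantumFields.YangMills.Theorems.MirrorModularBoostsHypercubicLimitSoftFloorsSubseq
import Summits.QuantumFields.YangMills.Theorems.MirrorModularBoostsHypercubicLimitPlaneSumGrowth
import Summits.QuantumFields.YangMills.Theorems.MirrorModularBoostsHypercubicLimitConvergenceSubseq
import Summits.QuantumFields.YangMills.Theorems.PencilRigidityWeakCouplingHypercubicLimitSiblingTie
import Summits.QuantumFields.YangMills.Theorems.LangevinControlUVOSLegsFromFemtoAndGapStubGap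
import Summits.QuantumFields.YangMills.Theorems.PencilRigidityWeakCouplingHypercubicLimitStubNtOfSkewSeparated
import Summits.QuantumFields.YangMills.Theorems.PencilRigidityWeakCouplingHypercubicLimitStubSkewSeparatedOfLatticeFloor
import Summits.QuantumFields.YangMills.Theorems.PencilRigidityWeakCouplingHypercubicLimitCountertermBoundMomentOne
import Summits.QuantumFields.YangMills.Theorems.PencilRigidityWeakCouplingHypercubicLimitGevreyMomentBounds
import HarnessLib

/-!
# Crux `WeakCouplingHypercubicLimit` (stmt-QuantumFields-16120), line `Sketch`, reshape r13: the GEVREY–SKEW core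

Lead c5 (process B).  The weakest lattice-side statement from which the landed machinery of both cruxes stmt-16120 / stmt-16154
closes: for every compact simple `G`, a faithful `r` and a Wilson scheme with
(W) `β_k → ∞`, (V) `PolyVolume`, (R) `PolyRenorm`,
(UV) GEVREY moment bounds `|∫ ∏ᵢ Φ^P_k(Fᵢ) dμ_k| ≤ C₀ C₁ⁿ (n!)^L` on normalised, pairwise plane-wise disjoint families (the
Osterwalder–Schrader E0′ currency; `UniformMomentBoundsPlanes` is the case `L = 1`),
(IR) a volume-uniform lattice mass gap `HasLatticeMassGap r sch Δ` with its RP-spectral form `RPSpectral r sch Δ C`, and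
(NG) ONE time-separated `κ₃` floor of the curvature (`f` at negative times, `g ⟂ h` at positive times).
Relative to the r11 common core (`…OfLatticeCore`): the non-triviality floor is DERIVED (process A's r12: `RPPos` ⇒ `ConnCS` ⇒
time-separated non-Gaussianity forces non-triviality, `stub_ntOfSkewSeparated` / `stub_skewSeparatedOfLatticeFloor`), the bounded
counterterm is DERIVED from the order-one moment bound + the `κ₃` floor (`countertermBound_of_momentOne_skewFloor`), and the functional
bound from the Gevrey moments (`functionalBoundPlanes_of_momentBoundsPow`).

* `oneFieldClauses_of_functionalBoundSkewCore` — the closure at the level it is consumed: weak coupling, `PolyVolume`, `PolyRenorm`,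
  bounded counterterms, `UniformFunctionalBoundPlanes`, gap + RP-spectral clustering, time-separated `κ₃` floor ⇒ a weak-coupling
  sub-scheme and a one-field family with `OneFieldClauses` (process A's r12 assembly from the compactness step on);
* `oneFieldClauses_of_latticeGevreySkewCore`, `hypercubicLimit_of_latticeGevreySkewCore`,
  `weakCouplingHypercubicLimit_of_latticeGevreySkewCore` — BOTH cruxes BY NAME from the Gevrey–skew core.

Refs: OsterwalderSchrader1973 §§2–4, OsterwalderSchrader1975 §2 and Appendix; OsterwalderSeiler1978 §§2–3; GlimmJaffe1987 §6.1, §19.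
-/

noncomputable section

open scoped SchwartzMap
open MeasureTheory Filter Topology
open Literature.MathematicalPhysics.AQFT Literature.MathematicalPhysics.QuantumLattice
open Literature.MathematicalPhysics.QuantumFieldTheory
open Summit.QuantumFields.YangMills.Cruxes.HypercubicLimit.CouplingResponse
open Summit.QuantumFields.YangMills.Cruxes.OSLegsFromFemtoAndGap.DlrCollarTransfer (conn Decay RPPos ConnCS)

namespace Summit.QuantumFields.YangMills.Theorems.WeakCouplingHypercubicLimit.TraceNormColdPressure

/-- **The closure at functional-bound level.**  Weak coupling, `PolyVolume`, `PolyRenorm`, bounded counterterms, the `k`-uniform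
functional bound `UniformFunctionalBoundPlanes`, the uniform lattice gap with its RP-spectral form and ONE time-separated `κ₃` floor give a
weak-coupling sub-scheme and a one-field family with `OneFieldClauses` (Z2 compactness ⇒ soft facts ∧ reflection facts ⇒ `ConnCS` ⇒
non-triviality from time-separated non-Gaussianity ⇒ `oneFieldClauses_of_halves`; process A's r12 assembly, started one step later).
[folklore] -/
theorem oneFieldClauses_of_functionalBoundSkewCore
    {G : Type} [Group G] [TopologicalSpace G] [IsTopologicalGroup G] [CompactSpace G] [MeasurableSpace G] [BorelSpace G]
    (r : LatticeRep G) (sch : SpeciesScheme (YMSpecies G))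
    (hw : sch.HasWeakCouplingLimit) (hpv : PolyVolume sch) (hpr : PolyRenorm r sch)
    (hbm : ∃ Cm : ℝ, ∀ k, |sch.m r.curvature k| ≤ Cm) (hUFB : UniformFunctionalBoundPlanes r sch)
    {Δ C : ℝ} (hΔ : 0 < Δ) (hgap : HasLatticeMassGap r sch Δ) (hrp : RPSpectral r sch Δ C)
    (hNG : ∃ (f g h : 𝓢(EuclideanSpace ℝ (Fin 4), ℝ)) (δ : ℝ),
        tsupport f ⊆ {y : EuclideanSpace ℝ (Fin 4) | y 0 < 0} ∧ tsupport g ⊆ {y : EuclideanSpace ℝ (Fin 4) | 0 < y 0} ∧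
        tsupport h ⊆ {y : EuclideanSpace ℝ (Fin 4) | 0 < y 0} ∧ Disjoint (tsupport g) (tsupport h) ∧ 0 < δ ∧
        ∀ᶠ k in atTop, δ ≤
          |latticeSchwinger r.ρ sch (fun s => s.F) k 3 (fun _ => r.curvature) ![f, g, h] -
            latticeSchwinger r.ρ sch (fun s => s.F) k 1 (fun _ => r.curvature) ![f] *
              latticeSchwinger r.ρ sch (fun s => s.F) k 2 (fun _ => r.curvature) ![g, h] -
            latticeSchwinger r.ρ sch (fun s => s.F) k 1 (fun _ => r.curvature) ![g] *
              latticeSchwinger r.ρ sch (fun s => s.F) k 2 (fun _ => r.curvature) ![f, h] -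
            latticeSchwinger r.ρ sch (fun s => s.F) k 1 (fun _ => r.curvature) ![h] *
              latticeSchwinger r.ρ sch (fun s => s.F) k 2 (fun _ => r.curvature) ![f, g] +
            2 * (latticeSchwinger r.ρ sch (fun s => s.F) k 1 (fun _ => r.curvature) ![f] *
              latticeSchwinger r.ρ sch (fun s => s.F) k 1 (fun _ => r.curvature) ![g] *
              latticeSchwinger r.ρ sch (fun s => s.F) k 1 (fun _ => r.curvature) ![h])|) :
    ∃ (sch' : SpeciesScheme (YMSpecies G)) (S₁ : SchwingerFamily (EuclideanSpace ℝ (Fin 4))),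
      sch'.HasWeakCouplingLimit ∧ OneFieldClauses r sch' S₁ := by
  -- compactness along a subsequence
  obtain ⟨φ, hφ, T, hPL⟩ := stub_planeLimits G r sch hUFB
  have hβ0 : ∀ᶠ k in atTop, 0 ≤ sch.β k := hw.eventually_ge_atTop 0
  -- soft facts
  obtain ⟨hE0, hE3⟩ := planeSum_isNormalized_isSymmetric G r sch φ T hPL
  have hE0' := planeSum_hasLinearGrowth G r sch φ T hPL
  have htr := stub_translationPlanesMono G r sch φ hφ T hpv hpr hUFB hPL
  have hconv := convergence_subseq_of_planeLimits G r sch φ hφ T hPL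
  -- reflection facts
  have hRP : RPPos (planeSum T) := stub_rpPosOfPlaneLimits G r sch φ hφ T hβ0 hUFB hPL
  have hSP := stub_signedPermOfPlaneLimits G r sch φ hφ T hUFB hPL
  have hD : Decay (planeSum T) Δ := stub_decayOfRPSpectral G r sch φ hφ T Δ C hΔ hpv hpr hbm hUFB hPL hrp
  have hrefl : ReflHalf (planeSum T) Δ :=
    reflHalf_of_pieces (planeSum T) hΔ hE0 (fun n _ a F hF => htr n a F hF) hRP hSP hD
  -- `ConnCS` of the limit (landed `stub_gap`)
  have hN' : ∀ F : 𝓢((Fin 0 → EuclideanSpace ℝ (Fin 4)), ℂ), planeSum T 0 F = F default := fun F =>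
    (hE0 (fun _ => ()) F).trans (congrArg F (Subsingleton.elim _ _))
  have htrans' : ∀ (n : ℕ) (t : EuclideanSpace ℝ (Fin 4)) (F : 𝓢((Fin n → EuclideanSpace ℝ (Fin 4)), ℂ)),
      IsOffDiagonal F → planeSum T n (translateMulti t F) = planeSum T n F := fun n t F hF => htr n t F hF
  obtain ⟨hCS, -⟩ :=
    Summit.QuantumFields.YangMills.Cruxes.OSLegsFromFemtoAndGap.DlrCollarTransfer.stub_gap (planeSum T) hN' htrans' hRP
  -- the κ₃ floor along the subsequence, its continuum (time-separated) non-Gaussianity data, non-triviality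
  have hNG' : ∃ (f g h : 𝓢(EuclideanSpace ℝ (Fin 4), ℝ)) (δ : ℝ),
      tsupport f ⊆ {y : EuclideanSpace ℝ (Fin 4) | y 0 < 0} ∧ tsupport g ⊆ {y : EuclideanSpace ℝ (Fin 4) | 0 < y 0} ∧
      tsupport h ⊆ {y : EuclideanSpace ℝ (Fin 4) | 0 < y 0} ∧ Disjoint (tsupport g) (tsupport h) ∧ 0 < δ ∧
      ∀ᶠ k in atTop, δ ≤
        |latticeSchwinger r.ρ (subseq sch φ hφ) (fun s => s.F) k 3 (fun _ => r.curvature) ![f, g, h] -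
          latticeSchwinger r.ρ (subseq sch φ hφ) (fun s => s.F) k 1 (fun _ => r.curvature) ![f] *
            latticeSchwinger r.ρ (subseq sch φ hφ) (fun s => s.F) k 2 (fun _ => r.curvature) ![g, h] -
          latticeSchwinger r.ρ (subseq sch φ hφ) (fun s => s.F) k 1 (fun _ => r.curvature) ![g] *
            latticeSchwinger r.ρ (subseq sch φ hφ) (fun s => s.F) k 2 (fun _ => r.curvature) ![f, h] -
          latticeSchwinger r.ρ (subseq sch φ hφ) (fun s => s.F) k 1 (fun _ => r.curvature) ![h] *
            latticeSchwinger r.ρ (subseq sch φ hφ) (fun s => s.F) k 2 (fun _ => r.curvature) ![f, g] +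
          2 * (latticeSchwinger r.ρ (subseq sch φ hφ) (fun s => s.F) k 1 (fun _ => r.curvature) ![f] *
            latticeSchwinger r.ρ (subseq sch φ hφ) (fun s => s.F) k 1 (fun _ => r.curvature) ![g] *
            latticeSchwinger r.ρ (subseq sch φ hφ) (fun s => s.F) k 1 (fun _ => r.curvature) ![h])| := by
    obtain ⟨f, g, h, δ, hf, hg, hh, hgh, hδ, hev⟩ := hNG
    exact ⟨f, g, h, δ, hf, hg, hh, hgh, hδ, eventually_subseq hφ hev⟩
  have hsep := stub_skewSeparatedOfLatticeFloor G r (subseq sch φ hφ) (planeSum T) hconv hNG'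
  have hNT := stub_ntOfSkewSeparated (planeSum T) hCS hsep
  have hNGc : ∃ (f g h : 𝓢(EuclideanSpace ℝ (Fin 4), ℂ)) (Ffgh : 𝓢((Fin 3 → EuclideanSpace ℝ (Fin 4)), ℂ))
      (Fgh Ffh Ffg : 𝓢((Fin 2 → EuclideanSpace ℝ (Fin 4)), ℂ)) (Ff Fg Fh : 𝓢((Fin 1 → EuclideanSpace ℝ (Fin 4)), ℂ)),
      IsTensorOf Ffgh ![f, g, h] ∧ IsOffDiagonal Ffgh ∧ IsTensorOf Fgh ![g, h] ∧
      IsTensorOf Ffh ![f, h] ∧ IsTensorOf Ffg ![f, g] ∧ IsTensorOf Ff ![f] ∧ IsTensorOf Fg ![g] ∧ IsTensorOf Fh ![h] ∧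
      (planeSum T).toLabelled 3 (fun _ => ()) Ffgh -
          (planeSum T).toLabelled 1 (fun _ => ()) Ff * (planeSum T).toLabelled 2 (fun _ => ()) Fgh -
        (planeSum T).toLabelled 1 (fun _ => ()) Fg * (planeSum T).toLabelled 2 (fun _ => ()) Ffh -
        (planeSum T).toLabelled 1 (fun _ => ()) Fh * (planeSum T).toLabelled 2 (fun _ => ()) Ffg +
        2 * ((planeSum T).toLabelled 1 (fun _ => ()) Ff * (planeSum T).toLabelled 1 (fun _ => ()) Fg *
          (planeSum T).toLabelled 1 (fun _ => ()) Fh) ≠ 0 := by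
    obtain ⟨f, g, h, Ffgh, Fgh, Ffh, Ffg, Ff, Fg, Fh, -, -, -, -, h1, h2, h3, h4, h5, h6, h7, h8, h9⟩ := hsep
    exact ⟨f, g, h, Ffgh, Fgh, Ffh, Ffg, Ff, Fg, Fh, h1, h2, h3, h4, h5, h6, h7, h8, h9⟩
  -- assemble the soft half and conclude
  have hsoft : SoftHalf r (subseq sch φ hφ) (planeSum T) Δ :=
    ⟨hE0, hE0', hE3, fun n _ a F hF => htr n a F hF, hconv, hNT, hNGc, hasLatticeMassGap_subseq r sch φ hφ hgap⟩
  exact ⟨subseq sch φ hφ, planeSum T, hasWeakCouplingLimit_subseq sch φ hφ hw, oneFieldClauses_of_halves r _ _ hΔ hsoft hrefl⟩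

/-- **The Gevrey–skew core gives a weak-coupling one-field witness**: the order-one instance of the Gevrey moment bound + the `κ₃`
floor bound the counterterms (`countertermBound_of_momentOne_skewFloor`), the Gevrey moment bounds give the functional bound
(`functionalBoundPlanes_of_momentBoundsPow`), and `oneFieldClauses_of_functionalBoundSkewCore` concludes. [folklore] -/
theorem oneFieldClauses_of_latticeGevreySkewCore
    {G : Type} [Group G] [TopologicalSpace G] [IsTopologicalGroup G] [CompactSpace G] [MeasurableSpace G] [BorelSpace G]
    (r : LatticeRep G) (sch : SpeciesScheme (YMSpecies G))
    (hw : sch.HasWeakCouplingLimit) (hpv : PolyVolume sch) (hpr : PolyRenorm r sch)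
    (hGev : ∃ (s L : ℕ) (C₀ C₁ : ℝ), ∀ (n : ℕ) (F : Fin n → Plane → 𝓢(EuclideanSpace ℝ (Fin 4), ℝ)),
      (∀ i, normP s (F i) ≤ 1) → (∀ i j, i ≠ j → DisjP (F i) (F j)) →
        ∀ k : ℕ, |∫ U, ∏ i, fieldP r sch k (F i) U ∂(wilsonAt r sch k)| ≤ C₀ * C₁ ^ n * (n.factorial : ℝ) ^ L)
    {Δ C : ℝ} (hΔ : 0 < Δ) (hgap : HasLatticeMassGap r sch Δ) (hrp : RPSpectral r sch Δ C)
    (hNG : ∃ (f g h : 𝓢(EuclideanSpace ℝ (Fin 4), ℝ)) (δ : ℝ),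
        tsupport f ⊆ {y : EuclideanSpace ℝ (Fin 4) | y 0 < 0} ∧ tsupport g ⊆ {y : EuclideanSpace ℝ (Fin 4) | 0 < y 0} ∧
        tsupport h ⊆ {y : EuclideanSpace ℝ (Fin 4) | 0 < y 0} ∧ Disjoint (tsupport g) (tsupport h) ∧ 0 < δ ∧
        ∀ᶠ k in atTop, δ ≤
          |latticeSchwinger r.ρ sch (fun s => s.F) k 3 (fun _ => r.curvature) ![f, g, h] -
            latticeSchwinger r.ρ sch (fun s => s.F) k 1 (fun _ => r.curvature) ![f] *
              latticeSchwinger r.ρ sch (fun s => s.F) k 2 (fun _ => r.curvature) ![g, h] -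
            latticeSchwinger r.ρ sch (fun s => s.F) k 1 (fun _ => r.curvature) ![g] *
              latticeSchwinger r.ρ sch (fun s => s.F) k 2 (fun _ => r.curvature) ![f, h] -
            latticeSchwinger r.ρ sch (fun s => s.F) k 1 (fun _ => r.curvature) ![h] *
              latticeSchwinger r.ρ sch (fun s => s.F) k 2 (fun _ => r.curvature) ![f, g] +
            2 * (latticeSchwinger r.ρ sch (fun s => s.F) k 1 (fun _ => r.curvature) ![f] *
              latticeSchwinger r.ρ sch (fun s => s.F) k 1 (fun _ => r.curvature) ![g] *
              latticeSchwinger r.ρ sch (fun s => s.F) k 1 (fun _ => r.curvature) ![h])|) :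
    ∃ (sch' : SpeciesScheme (YMSpecies G)) (S₁ : SchwingerFamily (EuclideanSpace ℝ (Fin 4))),
      sch'.HasWeakCouplingLimit ∧ OneFieldClauses r sch' S₁ := by
  -- the order-one instance of the Gevrey bound
  have hM : ∃ (s : ℕ) (C : ℝ), ∀ F : Plane → 𝓢(EuclideanSpace ℝ (Fin 4), ℝ), normP s F ≤ 1 →
      ∀ k : ℕ, |∫ U, fieldP r sch k F U ∂(wilsonAt r sch k)| ≤ C := by
    obtain ⟨s, L, C₀, C₁, hU⟩ := hGev
    refine ⟨s, C₀ * C₁ ^ 1 * ((Nat.factorial 1 : ℕ) : ℝ) ^ L, fun F hF k => ?_⟩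
    have h := hU 1 (fun _ => F) (fun _ => hF) (fun i j hij => absurd (Subsingleton.elim i j) hij) k
    simpa only [Fin.prod_univ_one] using h
  -- bounded counterterms from the κ₃ floor, functional bound from the Gevrey moments
  have hbm : ∃ Cm : ℝ, ∀ k, |sch.m r.curvature k| ≤ Cm := by
    obtain ⟨f, g, h, δ, -, -, -, -, hδ, hev⟩ := hNG
    exact countertermBound_of_momentOne_skewFloor G r sch hM ⟨f, g, h, δ, hδ, hev⟩
  have hUFB : UniformFunctionalBoundPlanes r sch := functionalBoundPlanes_of_momentBoundsPow G r sch hGev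
  exact oneFieldClauses_of_functionalBoundSkewCore r sch hw hpv hpr hbm hUFB hΔ hgap hrp hNG

/-- **The twin crux `HypercubicLimit` (stmt-16154) from the Gevrey–skew core.** [folklore] -/
theorem hypercubicLimit_of_latticeGevreySkewCore
    (hcore : ∀ (G : Type) [Group G] [TopologicalSpace G] [IsTopologicalGroup G] [CompactSpace G]
      [MeasurableSpace G] [BorelSpace G], IsCompactSimpleLieGroup G →
      ∃ (r : LatticeRep G) (sch : SpeciesScheme (YMSpecies G)),
        sch.HasWeakCouplingLimit ∧ PolyVolume sch ∧ PolyRenorm r sch ∧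
        (∃ (s L : ℕ) (C₀ C₁ : ℝ), ∀ (n : ℕ) (F : Fin n → Plane → 𝓢(EuclideanSpace ℝ (Fin 4), ℝ)),
          (∀ i, normP s (F i) ≤ 1) → (∀ i j, i ≠ j → DisjP (F i) (F j)) →
            ∀ k : ℕ, |∫ U, ∏ i, fieldP r sch k (F i) U ∂(wilsonAt r sch k)| ≤ C₀ * C₁ ^ n * (n.factorial : ℝ) ^ L) ∧
        (∃ Δ C : ℝ, 0 < Δ ∧ HasLatticeMassGap r sch Δ ∧ RPSpectral r sch Δ C) ∧
        (∃ (f g h : 𝓢(EuclideanSpace ℝ (Fin 4), ℝ)) (δ : ℝ),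
          tsupport f ⊆ {y : EuclideanSpace ℝ (Fin 4) | y 0 < 0} ∧ tsupport g ⊆ {y : EuclideanSpace ℝ (Fin 4) | 0 < y 0} ∧
          tsupport h ⊆ {y : EuclideanSpace ℝ (Fin 4) | 0 < y 0} ∧ Disjoint (tsupport g) (tsupport h) ∧ 0 < δ ∧
          ∀ᶠ k in atTop, δ ≤
            |latticeSchwinger r.ρ sch (fun s => s.F) k 3 (fun _ => r.curvature) ![f, g, h] -
              latticeSchwinger r.ρ sch (fun s => s.F) k 1 (fun _ => r.curvature) ![f] *
                latticeSchwinger r.ρ sch (fun s => s.F) k 2 (fun _ => r.curvature) ![g, h] -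
              latticeSchwinger r.ρ sch (fun s => s.F) k 1 (fun _ => r.curvature) ![g] *
                latticeSchwinger r.ρ sch (fun s => s.F) k 2 (fun _ => r.curvature) ![f, h] -
              latticeSchwinger r.ρ sch (fun s => s.F) k 1 (fun _ => r.curvature) ![h] *
                latticeSchwinger r.ρ sch (fun s => s.F) k 2 (fun _ => r.curvature) ![f, g] +
              2 * (latticeSchwinger r.ρ sch (fun s => s.F) k 1 (fun _ => r.curvature) ![f] *
                latticeSchwinger r.ρ sch (fun s => s.F) k 1 (fun _ => r.curvature) ![g] *
                latticeSchwinger r.ρ sch (fun s => s.F) k 1 (fun _ => r.curvature) ![h])|)) :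
    Summit.QuantumFields.YangMills.Theses.CoincidenceRotationBootstrap.HypercubicLimit := by
  refine Summit.QuantumFields.YangMills.Theorems.HypercubicLimit.OneFieldWeak.hypercubicLimit_iff_oneFieldWeak.mpr
    fun G _ _ _ _ hG => ?_
  letI : MeasurableSpace G := borel G
  haveI : BorelSpace G := ⟨rfl⟩
  obtain ⟨r, sch, hw, hpv, hpr, hGev, ⟨Δ, C, hΔ, hgap, hrp⟩, hNG⟩ := hcore G hG
  obtain ⟨sch', S₁, hw', h₁⟩ := oneFieldClauses_of_latticeGevreySkewCore r sch hw hpv hpr hGev hΔ hgap hrp hNG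
  exact ⟨r, sch', S₁, hw', h₁⟩

/-- **The crux `WeakCouplingHypercubicLimit` (stmt-16120) BY NAME from the Gevrey–skew core** — registered sub-goal of line
`Sketch`, r13 (heart = the hypothesis): weak coupling ∧ `PolyVolume` ∧ `PolyRenorm` ∧ GEVREY moment bounds ∧ (uniform lattice gap ∧
its RP-spectral form) ∧ ONE time-separated `κ₃` floor ⇒ the existence-minus-rotations leg of `YangMills` in one-field gauge at weak
coupling. [folklore] -/
theorem weakCouplingHypercubicLimit_of_latticeGevreySkewCore :
    (∀ (G : Type) [Group G] [TopologicalSpace G] [IsTopologicalGroup G] [CompactSpace G]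
      [MeasurableSpace G] [BorelSpace G], IsCompactSimpleLieGroup G →
      ∃ (r : LatticeRep G) (sch : SpeciesScheme (YMSpecies G)),
        sch.HasWeakCouplingLimit ∧ PolyVolume sch ∧ PolyRenorm r sch ∧
        (∃ (s L : ℕ) (C₀ C₁ : ℝ), ∀ (n : ℕ) (F : Fin n → Plane → 𝓢(EuclideanSpace ℝ (Fin 4), ℝ)),
          (∀ i, normP s (F i) ≤ 1) → (∀ i j, i ≠ j → DisjP (F i) (F j)) →
            ∀ k : ℕ, |∫ U, ∏ i, fieldP r sch k (F i) U ∂(wilsonAt r sch k)| ≤ C₀ * C₁ ^ n * (n.factorial : ℝ) ^ L) ∧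
        (∃ Δ C : ℝ, 0 < Δ ∧ HasLatticeMassGap r sch Δ ∧ RPSpectral r sch Δ C) ∧
        (∃ (f g h : 𝓢(EuclideanSpace ℝ (Fin 4), ℝ)) (δ : ℝ),
          tsupport f ⊆ {y : EuclideanSpace ℝ (Fin 4) | y 0 < 0} ∧ tsupport g ⊆ {y : EuclideanSpace ℝ (Fin 4) | 0 < y 0} ∧
          tsupport h ⊆ {y : EuclideanSpace ℝ (Fin 4) | 0 < y 0} ∧ Disjoint (tsupport g) (tsupport h) ∧ 0 < δ ∧
          ∀ᶠ k in atTop, δ ≤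
            |latticeSchwinger r.ρ sch (fun s => s.F) k 3 (fun _ => r.curvature) ![f, g, h] -
              latticeSchwinger r.ρ sch (fun s => s.F) k 1 (fun _ => r.curvature) ![f] *
                latticeSchwinger r.ρ sch (fun s => s.F) k 2 (fun _ => r.curvature) ![g, h] -
              latticeSchwinger r.ρ sch (fun s => s.F) k 1 (fun _ => r.curvature) ![g] *
                latticeSchwinger r.ρ sch (fun s => s.F) k 2 (fun _ => r.curvature) ![f, h] -
              latticeSchwinger r.ρ sch (fun s => s.F) k 1 (fun _ => r.curvature) ![h] *
                latticeSchwinger r.ρ sch (fun s => s.F) k 2 (fun _ => r.curvature) ![f, g] +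
              2 * (latticeSchwinger r.ρ sch (fun s => s.F) k 1 (fun _ => r.curvature) ![f] *
                latticeSchwinger r.ρ sch (fun s => s.F) k 1 (fun _ => r.curvature) ![g] *
                latticeSchwinger r.ρ sch (fun s => s.F) k 1 (fun _ => r.curvature) ![h])|)) →
    Summit.QuantumFields.YangMills.Theses.PencilRigidity.WeakCouplingHypercubicLimit := fun hcore =>
  Summit.QuantumFields.YangMills.Theorems.WeakCouplingHypercubicLimit.SiblingTie.stub_siblingTie.mpr
    (hypercubicLimit_of_latticeGevreySkewCore hcore)

end Summit.QuantumFields.YangMills.Theorems.WeakCouplingHypercubicLimit.TraceNormColdPressure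

end
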